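import Summits.MatrixMultiplication.OmegaCensus.STPPProductFamilies
import Summits.MatrixMultiplication.OmegaCensus.STPPPatternMonotonicity
import Summits.MatrixMultiplication.OmegaCensus.STPPSmallPatternLawBridge
import Summits.MatrixMultiplication.OmegaCensus.STPPSmallPatternOnsetLaws
import Summits.MatrixMultiplication.OmegaCensus.STPPSmallPatternT1K8OrderLaw45

/-!
# ω-census, small STPP patterns: the `T1 × T1` PRODUCT ROUTE — `(2,1,1)^m ⊆ H₁` and `(2,1,1)^n ⊆ H₂` give `(1,2,2)^{mn} ⊆ H₁ × H₂`

HONEST FRAMING (pub-omega census; verbatim): lottery ticket; floor = certified bounds/negative ranges.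
Census STRUCTURE tool of the STPP track (seat pub-omega-stpp-3, gen 28; STRUCTURE row B5, column `T2`), not progress on `ω`.

The CKSU product of STPP families (tree `IsSTPP.prod` / `exists_isSTPP_prod`) multiplies size patterns coordinatewise, and realisable size
patterns are closed under the rotation of roles (`exists_isSTPP_rotate`).  Rotating a `(2,1,1)` family of `H₁` to `(1,2,1)` and one of `H₂`
to `(1,1,2)` and multiplying yields a `(1·1, 2·1, 1·2) = (1,2,2)` family of `H₁ × H₂` with `m · n` triples:

* `exists_isSTPP_122_prod_of_211_le` — **if `H₁` hosts `(2,1,1)^m` and `H₂` hosts `(2,1,1)^n` then `H₁ × H₂` hosts `(1,2,2)^k` for every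
  `k ≤ m n`**;
* `exists_isSTPP_122_prod_of_211_le_of_leftInverse` — the same followed by an additive map with a left inverse (a coordinate shuffle onto a seed
  type, `rfl`-checked in the applications);
* worked instance `exists_isSTPP_122pow16_seed_7_7_7_t1t1`: `(1,2,2)¹⁶ ⊆ ℤ/7 × ℤ/7 × ℤ/7` from `(2,1,1)² ⊆ ℤ/7` (order `≥ 6`) and `(2,1,1)⁸ ⊆ ℤ/7 × ℤ/7`
  (order `49 ≥ 45`, ENG2's law) — a type that the `(1,2,2) × TSF` product route does not reach at `k = 16`.

This complements `STPPSmallPatternTSFProductRoute.lean` (`(1,2,2)^N ⊆ H` times a tricolored sum-free set) using ENG2's `(2,1,1)^k` ORDER LAWS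
(`…OnsetLaws`, `…T1K4/K6/K7OrderLaw`, `…T1K8OrderLaw45`, `…T1K9OrderLaw`: thresholds `6, 12, 18, 24, 30, 38, 45, 58`) on both factors.

References: H. Cohn, R. Kleinberg, B. Szegedy, C. Umans, FOCS 2005 (arXiv:math/0511460), Def. 5.1 and the product remark of §7.
-/

open Literature.Computability.AlgebraicComplexity Finset

namespace Summit.MatrixMultiplication.OmegaCensus

/-- **`T1 × T1` product route:** `(2,1,1)^m ⊆ H₁` and `(2,1,1)^n ⊆ H₂` give `(1,2,2)^k ⊆ H₁ × H₂` for every `k ≤ m·n` (rotate the roles to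
`(1,2,1)` and `(1,1,2)`, take the CKSU product, cut to `k` triples). [cite: CohnKleinbergSzegedyUmans2005, Def. 5.1] -/
theorem exists_isSTPP_122_prod_of_211_le {H₁ H₂ : Type*} [AddCommGroup H₁] [AddCommGroup H₂] [DecidableEq H₁] [DecidableEq H₂] {m n : ℕ}
    (h₁ : ∃ A B C : Fin m → Finset H₁, IsSTPP A B C ∧ ∀ i, (A i).card = 2 ∧ (B i).card = 1 ∧ (C i).card = 1)
    (h₂ : ∃ A B C : Fin n → Finset H₂, IsSTPP A B C ∧ ∀ i, (A i).card = 2 ∧ (B i).card = 1 ∧ (C i).card = 1)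
    (k : ℕ) (hk : k ≤ m * n) :
    ∃ A B C : Fin k → Finset (H₁ × H₂), IsSTPP A B C ∧ ∀ i, (A i).card = 1 ∧ (B i).card = 2 ∧ (C i).card = 2 := by
  -- rotate twice: (2,1,1) ↦ (1,1,2) ↦ (1,2,1) on `H₁`; once: (2,1,1) ↦ (1,1,2) on `H₂`
  have h₁' : ∃ A B C : Fin m → Finset H₁, IsSTPP A B C ∧ ∀ i, (A i).card = 1 ∧ (B i).card = 2 ∧ (C i).card = 1 :=
    exists_isSTPP_rotate (fun _ => 1) (fun _ => 1) (fun _ => 2)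
      (exists_isSTPP_rotate (fun _ => 2) (fun _ => 1) (fun _ => 1) h₁)
  have h₂' : ∃ A B C : Fin n → Finset H₂, IsSTPP A B C ∧ ∀ i, (A i).card = 1 ∧ (B i).card = 1 ∧ (C i).card = 2 :=
    exists_isSTPP_rotate (fun _ => 2) (fun _ => 1) (fun _ => 1) h₂
  obtain ⟨A, B, C, hS, hc⟩ := exists_isSTPP_prod h₁' h₂'
  have h : ∃ A B C : Fin (m * n) → Finset (H₁ × H₂), IsSTPP A B C ∧ ∀ i, (A i).card = 1 ∧ (B i).card = 2 ∧ (C i).card = 2 :=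
    ⟨A, B, C, hS, fun i => by simpa using hc i⟩
  exact exists_isSTPP_of_embedding (fun _ => 1) (fun _ => 2) (fun _ => 2) (fun _ => 1) (fun _ => 2) (fun _ => 2)
    (Fin.castLE hk) (Fin.castLE_injective hk) (fun _ => le_rfl) (fun _ => le_rfl) (fun _ => le_rfl) h

/-- **`T1 × T1` product route, transported** along an additive map `φ : H₁ × H₂ →+ G` with a left inverse (a coordinate shuffle onto a seed type
in the applications; `ψ ∘ φ = id` by `rfl`). [cite: CohnKleinbergSzegedyUmans2005, Def. 5.1] -/
theorem exists_isSTPP_122_prod_of_211_le_of_leftInverse {H₁ H₂ G : Type*} [AddCommGroup H₁] [AddCommGroup H₂] [AddCommGroup G]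
    [DecidableEq H₁] [DecidableEq H₂] {m n : ℕ}
    (h₁ : ∃ A B C : Fin m → Finset H₁, IsSTPP A B C ∧ ∀ i, (A i).card = 2 ∧ (B i).card = 1 ∧ (C i).card = 1)
    (h₂ : ∃ A B C : Fin n → Finset H₂, IsSTPP A B C ∧ ∀ i, (A i).card = 2 ∧ (B i).card = 1 ∧ (C i).card = 1)
    (k : ℕ) (hk : k ≤ m * n) (φ : H₁ × H₂ →+ G) (ψ : G → H₁ × H₂) (hψ : Function.LeftInverse ψ φ) :
    ∃ A B C : Fin k → Finset G, IsSTPP A B C ∧ ∀ i, (A i).card = 1 ∧ (B i).card = 2 ∧ (C i).card = 2 :=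
  exists_isSTPP_cards_of_injective φ hψ.injective (exists_isSTPP_122_prod_of_211_le h₁ h₂ k hk)

/-- Worked instance: **`(1,2,2)¹⁶ ⊆ ℤ/7 × ℤ/7 × ℤ/7`** from `(2,1,1)² ⊆ ℤ/7` (order `7 ≥ 6`) and `(2,1,1)⁸ ⊆ ℤ/7 × ℤ/7` (order `49 ≥ 45`), `2·8 = 16`.
[cite: CohnKleinbergSzegedyUmans2005, Def. 5.1] -/
theorem exists_isSTPP_122pow16_seed_7_7_7_t1t1 :
    ∃ A B C : Fin 16 → Finset (ZMod 7 × ZMod 7 × ZMod 7), IsSTPP A B C ∧ ∀ i, (A i).card = 1 ∧ (B i).card = 2 ∧ (C i).card = 2 :=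
  exists_isSTPP_122_prod_of_211_le (H₁ := ZMod 7) (H₂ := ZMod 7 × ZMod 7)
    (exists_isSTPP_211pow2_of_card_ge_6 (G := ZMod 7) (by simp))
    (exists_isSTPP_211pow8_of_card_ge_45 (G := ZMod 7 × ZMod 7) (by simp)) 16 (by norm_num)

end Summit.MatrixMultiplication.OmegaCensus
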